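import Summits.QuantumFields.YangMills.Theorems.SwapVirialDeficitBlowUpRingChartMeasure
import HarnessLib

/-!
# The RING CHART of the joint blow-up (brick J3 of memo-24197-massive-mode-rung), III: σ-glued sublevel volumes and ring integrals in
# leader ∕ follower coordinates — EXACTLY; the inner mass is a class function of the leaders; the toron box in chart coordinates; `card Fol = 6L⁴ − 3`
# (free-hands support of ⟨stmt-QuantumFields-24197⟩ `SwapVirialDeficit.SwapGluedStiffness`)

With ✓`BlowUpRing.ringConfig χ : (Fin 4 → SU(2)) × (Fol L → SU(2)) → X_fix` (measure preserving, ✓`measurePreserving_ringConfig`) and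
`chartDeficit L z χ (C, U) = F^S_z (glue w ∷ r, g)`, `(w, (r, g)) = ringConfig χ (C, U)`:

* §4 reading the coordinates (`ringConfig_fst_lead`: leaders `C_μ` at `(−ê_μ, μ)`; `ringConfig_fst_of_not_isLead`: `letter · U`; `ringConfig_snd_fst`:
  `glue(w)·U`; `ringConfig_snd_snd_zero ∕ _of_ne`: `c = C 3`, `χ(x)·c·U`); measurability of `fixHistory`, `ringConfig`, `chartDeficit`;
* §5 ★★ `lintegral_ringMeasure_eq_chart` — `∫ G dμ_L = ∫ G(glue w ∷ r, g) d(Haar⁴ ⊗ Haar^{Fol})` for every measurable `G ≥ 0` invariant under a re-indexed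
  seam action (tree gauge ✓`lintegral_ringMeasure_eq_treeGauge_seam` + Tonelli + `measurePreserving_ringConfig`); ★★ `integral_exp_swapDeficit_eq_chart`;
  ★★★ `ringMeasure_swapDeficit_le_eq_chart` ∕ `ringMeasure_real_swapDeficit_le_eq_chart` — `μ_L{F^S_z ≤ s} = (Haar⁴ ⊗ Haar^{Fol}){chartDeficit L z χ ≤ s}`;
  ★★★ `ringMeasure_swapDeficit_le_eq_lintegral` — `= ∫ Haar^{Fol}{U | chartDeficit (C, U) ≤ s} dHaar⁴(C)` (THE FRAME in which the leader chart J2 and the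
  follower chart J1 ✓`BlowUp.lintegral_haar_pi_eq_followerChart` compose to the scaling identity (S) of ✓`BlowUp.smallBall_limit_real_of_blowUp_of_weight`);
* §6 ★ `ringConfig_conj`, ★ `chartDeficit_conj` — simultaneous conjugation of `(C, U)` = the constant gauge transformation = a re-indexed seam action
  (✓`swapRingDeficit_seamGaugeAct`, ✓`glue_conj'`), for central `χ`; ★★ `pi_chartDeficit_le_conj` — the inner mass is a CLASS FUNCTION of the leaders
  (memo §3(i): the hypothesis of the leader chart's `straighten` step);
* §7 ★★ `chartBox_of_chartDeficit` — ✓`swapCommBox_of_swapRingDeficit` in chart coordinates: leaders `60L³√F`-intertwined, EVERY follower within `48L³√F`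
  of `1`; ★ `card_fol : card (Fol L) = 6L⁴ − 3` (so the follower Jacobian of J1 at `t = √u` is `u^{(18L⁴−9)/2}`).

HONEST LABEL: exact measure-theoretic bookkeeping for the σ-glued ring at fixed `L` (plan-level plumbing of a DRAFT line); the scaling identity (S) itself
waits for the leader chart (J2); NOT ⟨24197⟩ ∕ ⟨24194⟩ ∕ ⟨24497⟩; no crux, rung or summit is proved; the Yang–Mills mass gap is NOT proved; no summit is
proved by a line.  THEOREMS ONLY (0 `def`, 0 `sorry`), standard axioms.  Width seat ym-line-sfw-p2-w2 g57 (cell ym-idea-1, free hands),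
`--supports stmt-QuantumFields-24197`.  References: [cite: tHooft1979]; [cite: Luscher1983, §2]; [cite: SeilerLNP1982, §2]; [cite: Chatterjee2016, Lemma 9.3]; [folklore].
-/

set_option autoImplicit false

noncomputable section

open MeasureTheory
open scoped BigOperators ENNReal
open Literature.MathematicalPhysics.QuantumFieldTheory hiding SU2
open Literature.MathematicalPhysics.QuantumLattice

namespace Summit.QuantumFields.YangMills.Theorems.SwapVirialDeficit.BlowUpRing

open Summit.QuantumFields.YangMills.Theorems.FemtoTransferGap
open Summit.QuantumFields.YangMills.Theorems.FemtoTransferGap.TT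
open Summit.QuantumFields.YangMills.Theorems.VirialFluxGap.RingDeficit
open Summit.QuantumFields.YangMills.Theorems.VirialFluxGap.FixSplit (FixSpace card_offIdx measurePreserving_insertAt)
open Summit.QuantumFields.YangMills.Theorems.SwapTwistDeficit.PeriodicRingFloor
open Summit.QuantumFields.YangMills.Theorems.SwapVirialDeficit.SwapRing

variable {L : ℕ} [NeZero L]

/-! ## §4 Reading the rebuilt coordinates -/

omit [NeZero L] in
/-- Slice `0` rebuilt, at a leader: `sliceZero C V (−ê_μ, μ) = C μ`. [folklore] -/
@[simp] theorem sliceZero_lead (C : Fin 3 → SU2) (V : NonLead L → SU2) (μ : Fin 3) :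
    sliceZero C V ⟨(Pi.single μ (-1 : ZMod L), μ), leader_not_treeEdge μ⟩ = C μ := by
  unfold sliceZero; rw [dif_pos (isLead_lead μ)]

omit [NeZero L] in
/-- Slice `0` rebuilt, off the leaders: `letter · V_i`. [folklore] -/
theorem sliceZero_of_not_isLead (C : Fin 3 → SU2) (V : NonLead L → SU2) (i : NonLead L) :
    sliceZero C V i.1 = letter C i.1 * V i := by
  unfold sliceZero; rw [dif_neg i.2]

omit [NeZero L] in
/-- The seam rebuilt, at the origin: `c`. [folklore] -/
@[simp] theorem seamField_zero (χ : Site 3 L → SU2) (c : SU2) (V : SeamRest L → SU2) : seamField χ c V 0 = c := by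
  unfold seamField; rw [dif_pos rfl]

omit [NeZero L] in
/-- The seam rebuilt, off the origin: `χ(x)·c·V_x`. [folklore] -/
theorem seamField_of_ne (χ : Site 3 L → SU2) (c : SU2) (V : SeamRest L → SU2) (x : SeamRest L) :
    seamField χ c V x.1 = χ x.1 * c * V x := by
  unfold seamField; rw [dif_neg x.2]

/-- `ringConfig`, slice `0` at the leader of direction `μ`: `C μ`. [folklore] -/
@[simp] theorem ringConfig_fst_lead (χ : Site 3 L → SU2) (q : (Fin 4 → SU2) × (Fol L → SU2)) (μ : Fin 3) :
    (ringConfig χ q).1 ⟨(Pi.single μ (-1 : ZMod L), μ), leader_not_treeEdge μ⟩ = q.1 (Fin.castSucc μ) :=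
  sliceZero_lead (fun ν => q.1 (Fin.castSucc ν)) (fun i => q.2 (Sum.inl i)) μ

/-- `ringConfig`, slice `0` off the leaders: `letter · U_i`. [folklore] -/
theorem ringConfig_fst_of_not_isLead (χ : Site 3 L → SU2) (q : (Fin 4 → SU2) × (Fol L → SU2)) (i : NonLead L) :
    (ringConfig χ q).1 i.1 = letter (fun μ => q.1 (Fin.castSucc μ)) i.1 * q.2 (Sum.inl i) :=
  sliceZero_of_not_isLead (fun ν => q.1 (Fin.castSucc ν)) (fun i => q.2 (Sum.inl i)) i

/-- `ringConfig`, the slices: `r_j e = glue(w) e · U_(j,e)`. [folklore] -/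
@[simp] theorem ringConfig_snd_fst (χ : Site 3 L → SU2) (q : (Fin 4 → SU2) × (Fol L → SU2)) (j : Fin (2 * L - 1)) (e : Edge 3 L) :
    (ringConfig χ q).2.1 j e = glue (ringConfig χ q).1 e * q.2 (Sum.inr (Sum.inl (j, e))) := rfl

/-- `ringConfig`, the seam at the origin: `c = C 3`. [folklore] -/
@[simp] theorem ringConfig_snd_snd_zero (χ : Site 3 L → SU2) (q : (Fin 4 → SU2) × (Fol L → SU2)) :
    (ringConfig χ q).2.2 0 = q.1 (Fin.last 3) :=
  seamField_zero χ (q.1 (Fin.last 3)) (fun x => q.2 (Sum.inr (Sum.inr x)))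

/-- `ringConfig`, the seam off the origin: `χ(x)·c·U_x`. [folklore] -/
theorem ringConfig_snd_snd_of_ne (χ : Site 3 L → SU2) (q : (Fin 4 → SU2) × (Fol L → SU2)) (x : SeamRest L) :
    (ringConfig χ q).2.2 x.1 = χ x.1 * q.1 (Fin.last 3) * q.2 (Sum.inr (Sum.inr x)) :=
  seamField_of_ne χ (q.1 (Fin.last 3)) (fun x => q.2 (Sum.inr (Sum.inr x))) x

/-- `fixHistory` is measurable. [folklore] -/
theorem measurable_fixHistory : Measurable (fixHistory (L := L)) :=
  (measurable_ringCons (L := L)).comp ((measurable_glue.comp measurable_fst).prodMk measurable_snd)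

/-- `ringConfig χ` is measurable. [folklore] -/
theorem measurable_ringConfig (χ : Site 3 L → SU2) : Measurable (ringConfig (L := L) χ) :=
  (measurePreserving_ringConfig χ).measurable

/-- `chartDeficit L z χ` is measurable. [folklore] -/
theorem measurable_chartDeficit (z : Fin 3 → Bool) (χ : Site 3 L → SU2) : Measurable (chartDeficit L z χ) :=
  (measurable_swapRingDeficit z).comp (measurable_fixHistory.comp (measurable_ringConfig χ))

/-- `0 ≤ chartDeficit`. [cite: Luscher1983, §2] -/
theorem chartDeficit_nonneg (z : Fin 3 → Bool) (χ : Site 3 L → SU2) (q : (Fin 4 → SU2) × (Fol L → SU2)) : 0 ≤ chartDeficit L z χ q :=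
  swapRingDeficit_nonneg z _

/-! ## §5 Ring integrals and σ-glued sublevel volumes in leader ∕ follower coordinates — exactly -/

/-- ★★ **THE RING INTEGRAL IN THE CHART**: for measurable `G ≥ 0` invariant under a re-indexed seam action `(U⃗, g) ↦ (h·U⃗, h·g·(h∘κ)⁻¹)` (any site
map `κ`), `∫ G dμ_L = ∫ G (glue w ∷ r, g) d(Haar⁴ ⊗ Haar^{Fol})(C, U)` with `(w, (r, g)) = ringConfig χ (C, U)` (tree gauge
✓`lintegral_ringMeasure_eq_treeGauge_seam`, Tonelli, `measurePreserving_ringConfig`). [cite: SeilerLNP1982, §2] -/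
theorem lintegral_ringMeasure_eq_chart (κ : Site 3 L → Site 3 L) (χ : Site 3 L → SU2)
    {G : (Fin (2 * L - 1 + 1) → GaugeConfig 3 L SU2) × (Site 3 L → SU2) → ℝ≥0∞} (hG : Measurable G)
    (hinv : ∀ (h : Site 3 L → SU2) (p : (Fin (2 * L - 1 + 1) → GaugeConfig 3 L SU2) × (Site 3 L → SU2)),
      G ((fun i => gaugeTransform h (p.1 i)), h * p.2 * (h ∘ κ)⁻¹) = G p) :
    ∫⁻ p, G p ∂(ringMeasure L) =
      ∫⁻ q, G (fixHistory (ringConfig χ q))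
        ∂((Measure.pi fun _ : Fin 4 => haarProbability SU2).prod (Measure.pi fun _ : Fol L => haarProbability SU2)) := by
  haveI : IsProbabilityMeasure (gaugeMeasure L) := isProbabilityMeasure_gaugeMeasure (L := L)
  have hGf : Measurable fun x : FixSpace L => G (fixHistory x) := hG.comp measurable_fixHistory
  have h1 : ∫⁻ x, G (fixHistory x) ∂((Measure.pi fun _ : OffIdx L => haarProbability SU2).prod
      ((Measure.pi fun _ : Fin (2 * L - 1) => configMeasure SU2 L).prod (gaugeMeasure L))) =
      ∫⁻ w, ∫⁻ r, G (fixHistory (w, r)) ∂((Measure.pi fun _ : Fin (2 * L - 1) => configMeasure SU2 L).prod (gaugeMeasure L))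
        ∂(Measure.pi fun _ : OffIdx L => haarProbability SU2) :=
    lintegral_prod _ hGf.aemeasurable
  have h2 : ∫⁻ q, G (fixHistory (ringConfig χ q))
        ∂((Measure.pi fun _ : Fin 4 => haarProbability SU2).prod (Measure.pi fun _ : Fol L => haarProbability SU2)) =
      ∫⁻ x, G (fixHistory x) ∂((Measure.pi fun _ : OffIdx L => haarProbability SU2).prod
        ((Measure.pi fun _ : Fin (2 * L - 1) => configMeasure SU2 L).prod (gaugeMeasure L))) :=
    (measurePreserving_ringConfig χ).lintegral_comp hGf
  rw [lintegral_ringMeasure_eq_treeGauge_seam κ hG hinv, h2, h1]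
  rfl

/-- ★★ **The σ-glued Laplace integral in the chart**: `∫ e^{−bF^S_z} dμ_L = ∫ e^{−b·chartDeficit} d(Haar⁴ ⊗ Haar^{Fol})`, `b ≥ 0`. [cite: tHooft1979]
[cite: SeilerLNP1982, §2] -/
theorem integral_exp_swapDeficit_eq_chart (z : Fin 3 → Bool) (χ : Site 3 L → SU2) {b : ℝ} (hb : 0 ≤ b) :
    ∫ p, Real.exp (-(b * swapRingDeficit L z p)) ∂(ringMeasure L) =
      ∫ q, Real.exp (-(b * chartDeficit L z χ q))
        ∂((Measure.pi fun _ : Fin 4 => haarProbability SU2).prod (Measure.pi fun _ : Fol L => haarProbability SU2)) := by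
  rw [integral_exp_swapDeficit_eq_fix z hb, ← (measurePreserving_ringConfig χ).map_eq,
    integral_map (measurable_ringConfig χ).aemeasurable]
  · rfl
  · exact (((measurable_swapRingDeficit z).comp measurable_fixHistory).const_mul b).neg.exp.aestronglyMeasurable

/-- ★★★ **THE σ-GLUED SUBLEVEL VOLUMES IN LEADER ∕ FOLLOWER COORDINATES, EXACTLY**:
`μ_L{F^S_z ≤ s} = (Haar⁴ ⊗ Haar^{Fol}){(C, U) | chartDeficit L z χ (C, U) ≤ s}` (tree gauge ✓`measureReal_swapDeficit_le_eq_fix`, then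
`measurePreserving_ringConfig`). [cite: tHooft1979] [cite: Luscher1983, §2] [cite: SeilerLNP1982, §2] -/
theorem ringMeasure_swapDeficit_le_eq_chart (z : Fin 3 → Bool) (χ : Site 3 L → SU2) (s : ℝ) :
    (ringMeasure L) {P | swapRingDeficit L z P ≤ s} =
      ((Measure.pi fun _ : Fin 4 => haarProbability SU2).prod (Measure.pi fun _ : Fol L => haarProbability SU2))
        {q | chartDeficit L z χ q ≤ s} := by
  have hS : MeasurableSet {P : (Fin (2 * L - 1 + 1) → GaugeConfig 3 L SU2) × (Site 3 L → SU2) | swapRingDeficit L z P ≤ s} :=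
    measurableSet_le (measurable_swapRingDeficit z) measurable_const
  have hT : MeasurableSet {q : (Fin 4 → SU2) × (Fol L → SU2) | chartDeficit L z χ q ≤ s} :=
    measurableSet_le (measurable_chartDeficit z χ) measurable_const
  rw [← lintegral_indicator_one hS, ← lintegral_indicator_one hT]
  rw [lintegral_ringMeasure_eq_chart (⇑(sitePerm (L := L) (Equiv.swap (0 : Fin 3) 1))) χ (measurable_one.indicator hS)
    (fun h p => by simp only [Set.indicator_apply, Set.mem_setOf_eq, swapRingDeficit_seamGaugeAct, Pi.one_apply])]
  refine lintegral_congr fun q => ?_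
  simp only [Set.indicator_apply, Set.mem_setOf_eq, chartDeficit, Pi.one_apply]

/-- ★★★ The same in real numbers: `μ_L.real{F^S_z ≤ s} = (Haar⁴ ⊗ Haar^{Fol}).real{chartDeficit ≤ s}`. [cite: tHooft1979] [cite: Luscher1983, §2] -/
theorem ringMeasure_real_swapDeficit_le_eq_chart (z : Fin 3 → Bool) (χ : Site 3 L → SU2) (s : ℝ) :
    (ringMeasure L).real {P | swapRingDeficit L z P ≤ s} =
      ((Measure.pi fun _ : Fin 4 => haarProbability SU2).prod (Measure.pi fun _ : Fol L => haarProbability SU2)).real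
        {q | chartDeficit L z χ q ≤ s} := by
  rw [measureReal_def, measureReal_def, ringMeasure_swapDeficit_le_eq_chart]

/-- ★★★ **FUBINI FORM**: `μ_L{F^S_z ≤ s} = ∫ Haar^{Fol}{U | chartDeficit L z χ (C, U) ≤ s} dHaar⁴(C)` — the frame in which the leader chart (outer
integral) and the follower chart ✓`BlowUp.lintegral_haar_pi_eq_followerChart` (inner mass) compose. [cite: tHooft1979] [cite: Luscher1983, §2] -/
theorem ringMeasure_swapDeficit_le_eq_lintegral (z : Fin 3 → Bool) (χ : Site 3 L → SU2) (s : ℝ) :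
    (ringMeasure L) {P | swapRingDeficit L z P ≤ s} =
      ∫⁻ C, (Measure.pi fun _ : Fol L => haarProbability SU2) {U | chartDeficit L z χ (C, U) ≤ s}
        ∂(Measure.pi fun _ : Fin 4 => haarProbability SU2) := by
  have hT : MeasurableSet {q : (Fin 4 → SU2) × (Fol L → SU2) | chartDeficit L z χ q ≤ s} :=
    measurableSet_le (measurable_chartDeficit z χ) measurable_const
  rw [ringMeasure_swapDeficit_le_eq_chart z χ, Measure.prod_apply hT]
  rfl

/-- The inner mass `C ↦ Haar^{Fol}{U | chartDeficit (C, U) ≤ s}` is measurable. [folklore] -/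
theorem measurable_pi_chartDeficit_le (z : Fin 3 → Bool) (χ : Site 3 L → SU2) (s : ℝ) :
    Measurable fun C : Fin 4 → SU2 => (Measure.pi fun _ : Fol L => haarProbability SU2) {U | chartDeficit L z χ (C, U) ≤ s} :=
  measurable_measure_prodMk_left (measurableSet_le (measurable_chartDeficit z χ) measurable_const)

/-! ## §6 Invariance under simultaneous conjugation (the hypothesis of the leader chart, memo §3(i)) -/

omit [NeZero L] in
/-- Letters of conjugated leaders are conjugated letters. [folklore] -/
theorem letter_conj (k : SU2) (C : Fin 3 → SU2) (i : OffIdx L) : letter (fun μ => k * C μ * k⁻¹) i = k * letter C i * k⁻¹ := by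
  unfold letter
  by_cases h : i.1.1 i.1.2 = -1
  · rw [if_pos h, if_pos h]
  · rw [if_neg h, if_neg h, mul_one, mul_inv_cancel]

omit [NeZero L] in
/-- Slice `0` rebuilt from conjugated data is the conjugated slice. [folklore] -/
theorem sliceZero_conj (k : SU2) (C : Fin 3 → SU2) (V : NonLead L → SU2) :
    sliceZero (fun μ => k * C μ * k⁻¹) (fun i => k * V i * k⁻¹) = fun i => k * sliceZero C V i * k⁻¹ := by
  funext i
  unfold sliceZero
  by_cases h : isLead i = true
  · rw [dif_pos h, dif_pos h]
  · rw [dif_neg h, dif_neg h, letter_conj]; group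

omit [NeZero L] in
/-- The seam rebuilt from conjugated data is the conjugated seam, when `χ` is central. [folklore] -/
theorem seamField_conj {χ : Site 3 L → SU2} (hχ : ∀ (x : Site 3 L) (k : SU2), k * χ x = χ x * k) (k c : SU2) (V : SeamRest L → SU2) :
    seamField χ (k * c * k⁻¹) (fun x => k * V x * k⁻¹) = fun x => k * seamField χ c V x * k⁻¹ := by
  funext x
  unfold seamField
  by_cases h : x = 0
  · rw [dif_pos h, dif_pos h]
  · rw [dif_neg h, dif_neg h]
    simp only [← mul_assoc]
    rw [hχ x k]
    group

/-- ★ **`ringConfig` INTERTWINES SIMULTANEOUS CONJUGATION WITH THE CONSTANT GAUGE TRANSFORMATION** (for central `χ`):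
`ringConfig χ (kCk⁻¹, kUk⁻¹) = (k w k⁻¹, (r^{k}, k g k⁻¹))` (`glue (kwk⁻¹) = (glue w)^{k}`, ✓`glue_conj'`). [folklore] -/
theorem ringConfig_conj {χ : Site 3 L → SU2} (hχ : ∀ (x : Site 3 L) (k : SU2), k * χ x = χ x * k) (k : SU2)
    (q : (Fin 4 → SU2) × (Fol L → SU2)) :
    ringConfig χ ((fun m => k * q.1 m * k⁻¹), (fun i => k * q.2 i * k⁻¹)) =
      ((fun i => k * (ringConfig χ q).1 i * k⁻¹),
        ((fun j => gaugeTransform (fun _ : Site 3 L => k) ((ringConfig χ q).2.1 j)), (fun x => k * (ringConfig χ q).2.2 x * k⁻¹))) := by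
  have h0 : (ringConfig χ ((fun m => k * q.1 m * k⁻¹), (fun i => k * q.2 i * k⁻¹))).1 = fun i => k * (ringConfig χ q).1 i * k⁻¹ :=
    sliceZero_conj k (fun ν => q.1 (Fin.castSucc ν)) (fun i => q.2 (Sum.inl i))
  refine Prod.ext h0 (Prod.ext ?_ ?_)
  · funext j e
    show _ = gaugeTransform (fun _ : Site 3 L => k) ((ringConfig χ q).2.1 j) e
    rw [gaugeTransform_const_apply]
    show glue (ringConfig χ ((fun m => k * q.1 m * k⁻¹), (fun i => k * q.2 i * k⁻¹))).1 e * (k * q.2 (Sum.inr (Sum.inl (j, e))) * k⁻¹) =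
      k * (glue (ringConfig χ q).1 e * q.2 (Sum.inr (Sum.inl (j, e)))) * k⁻¹
    rw [h0, glue_conj', gaugeTransform_const_apply]
    group
  · exact seamField_conj hχ k (q.1 (Fin.last 3)) (fun x => q.2 (Sum.inr (Sum.inr x)))

/-- ★ **`chartDeficit` IS INVARIANT UNDER SIMULTANEOUS CONJUGATION of leaders and followers** (central `χ`): the constant gauge transformation `k` acts on
the ring history of `ringConfig χ (C, U)` as the re-indexed seam action, under which `F^S_z` is invariant (✓`swapRingDeficit_seamGaugeAct`). [cite: tHooft1979] -/
theorem chartDeficit_conj (z : Fin 3 → Bool) {χ : Site 3 L → SU2} (hχ : ∀ (x : Site 3 L) (k : SU2), k * χ x = χ x * k) (k : SU2)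
    (q : (Fin 4 → SU2) × (Fol L → SU2)) :
    chartDeficit L z χ ((fun m => k * q.1 m * k⁻¹), (fun i => k * q.2 i * k⁻¹)) = chartDeficit L z χ q := by
  unfold chartDeficit fixHistory
  rw [ringConfig_conj hχ k q]
  have h := swapRingDeficit_seamGaugeAct (L := L) z (fun _ : Site 3 L => k) (fixHistory (ringConfig χ q))
  unfold fixHistory at h
  refine Eq.trans ?_ h
  congr 1
  refine Prod.ext ?_ ?_
  · funext i
    refine Fin.cases ?_ (fun j => ?_) i
    · simp only [Fin.cons_zero, glue_conj']
    · simp only [Fin.cons_succ]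
  · funext x
    simp only [Pi.mul_apply, Pi.inv_apply, Function.comp_apply]

/-- Simultaneous conjugation of the followers preserves `Haar^{Fol}`. [folklore] -/
theorem measurePreserving_conj_fol (k : SU2) :
    MeasurePreserving (fun (U : Fol L → SU2) (i : Fol L) => k * U i * k⁻¹) (Measure.pi fun _ : Fol L => haarProbability SU2)
      (Measure.pi fun _ : Fol L => haarProbability SU2) :=
  measurePreserving_pi (fun _ : Fol L => haarProbability SU2) (fun _ : Fol L => haarProbability SU2)
    fun _ => measurePreserving_mul_mul_inv_haarProbability k k

/-- ★★ **THE INNER MASS IS A CLASS FUNCTION OF THE LEADERS**: `Haar^{Fol}{U | chartDeficit (kCk⁻¹, U) ≤ s} = Haar^{Fol}{U | chartDeficit (C, U) ≤ s}`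
(central `χ`) — the invariance under simultaneous conjugation that the leader chart (J2: cone⁴ → arrange → straighten → translate → dilate) consumes.
[cite: tHooft1979] -/
theorem pi_chartDeficit_le_conj (z : Fin 3 → Bool) {χ : Site 3 L → SU2} (hχ : ∀ (x : Site 3 L) (k : SU2), k * χ x = χ x * k) (k : SU2)
    (C : Fin 4 → SU2) (s : ℝ) :
    (Measure.pi fun _ : Fol L => haarProbability SU2) {U | chartDeficit L z χ ((fun m => k * C m * k⁻¹), U) ≤ s} =
      (Measure.pi fun _ : Fol L => haarProbability SU2) {U | chartDeficit L z χ (C, U) ≤ s} := by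
  have hT : MeasurableSet {U : Fol L → SU2 | chartDeficit L z χ (C, U) ≤ s} :=
    measurableSet_le ((measurable_chartDeficit z χ).comp (measurable_const.prodMk measurable_id)) measurable_const
  have hset : {U : Fol L → SU2 | chartDeficit L z χ ((fun m => k * C m * k⁻¹), U) ≤ s} =
      (fun (U : Fol L → SU2) (i : Fol L) => k⁻¹ * U i * k⁻¹⁻¹) ⁻¹' {U | chartDeficit L z χ (C, U) ≤ s} := by
    ext U
    simp only [Set.mem_preimage, Set.mem_setOf_eq]
    have h := chartDeficit_conj z hχ k⁻¹ ((fun m => k * C m * k⁻¹), U)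
    have hC : (fun m => k⁻¹ * (k * C m * k⁻¹) * k⁻¹⁻¹) = C := by funext m; group
    simp only [hC] at h
    rw [← h]
  rw [hset]
  exact (measurePreserving_conj_fol (L := L) k⁻¹).measure_preimage hT.nullMeasurableSet

/-! ## §7 The σ-twisted toron box in chart coordinates and the follower count -/

/-- ★★ **THE BOX OF ✓`swapCommBox_of_swapRingDeficit` IN CHART COORDINATES** (principal sector, `χ ≡ 1`): with `δ = √(chartDeficit L 0 1 (C, U))`, the
leaders satisfy `‖C_μC_ν − C_νC_μ‖_F ≤ 60L³δ`, `‖c·C_{σμ} − C_μ·c‖_F ≤ 60L³δ` (`c = C 3`), and EVERY FOLLOWER IS WITHIN `48L³δ` OF THE IDENTITY,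
`‖U_i − 1‖_F ≤ 48L³δ` — the followers are exactly the relative coordinates of that box. [cite: Luscher1983, §2] [cite: tHooft1979] -/
theorem chartBox_of_chartDeficit (q : (Fin 4 → SU2) × (Fol L → SU2)) :
    (∀ μ ν : Fin 3, frobNorm (((q.1 (Fin.castSucc μ) * q.1 (Fin.castSucc ν) : SU2) : Matrix (Fin 2) (Fin 2) ℂ) -
        ((q.1 (Fin.castSucc ν) * q.1 (Fin.castSucc μ) : SU2) : Matrix (Fin 2) (Fin 2) ℂ)) ≤
      60 * (L : ℝ) ^ 3 * Real.sqrt (chartDeficit L (fun _ => false) (fun _ => 1) q)) ∧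
    (∀ μ : Fin 3, frobNorm (((q.1 (Fin.last 3) * q.1 (Fin.castSucc (Equiv.swap (0 : Fin 3) 1 μ)) : SU2) : Matrix (Fin 2) (Fin 2) ℂ) -
        ((q.1 (Fin.castSucc μ) * q.1 (Fin.last 3) : SU2) : Matrix (Fin 2) (Fin 2) ℂ)) ≤
      60 * (L : ℝ) ^ 3 * Real.sqrt (chartDeficit L (fun _ => false) (fun _ => 1) q)) ∧
    (∀ i : Fol L, frobNorm (((q.2 i : SU2) : Matrix (Fin 2) (Fin 2) ℂ) - 1) ≤
      48 * (L : ℝ) ^ 3 * Real.sqrt (chartDeficit L (fun _ => false) (fun _ => 1) q)) := by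
  obtain ⟨hCC, hcC, hw, hr, hg⟩ := swapCommBox_of_swapRingDeficit (ringConfig (fun _ => 1) q).1 (ringConfig (fun _ => 1) q).2.1
    (ringConfig (fun _ => 1) q).2.2
  have hF : swapRingDeficit L (fun _ => false) ((Fin.cons (glue (ringConfig (fun _ => 1) q).1) (ringConfig (fun _ => 1) q).2.1 :
      Fin (2 * L - 1 + 1) → GaugeConfig 3 L SU2), (ringConfig (fun _ => 1) q).2.2) = chartDeficit L (fun _ => false) (fun _ => 1) q := rfl
  simp only [hF, ringConfig_fst_lead, ringConfig_snd_snd_zero] at hCC hcC hw hr hg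
  refine ⟨hCC, hcC, fun i => ?_⟩
  rcases i with i | ⟨j, e⟩ | x
  · have h := hw i.1
    rw [ringConfig_fst_of_not_isLead] at h
    have hl : (if i.1.1.1 i.1.1.2 = -1 then q.1 (Fin.castSucc i.1.1.2) else 1) = letter (fun μ => q.1 (Fin.castSucc μ)) i.1 := rfl
    rwa [hl, inv_mul_cancel_left] at h
  · have h := hr j e
    rwa [ringConfig_snd_fst, inv_mul_cancel_left] at h
  · have h := hg x.1
    rwa [ringConfig_snd_snd_of_ne, one_mul, inv_mul_cancel_left] at h

/-- The leaders of slice `0` are three: `{i // isLead i} ≃ Fin 3`. [folklore] -/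
theorem card_isLead : Fintype.card {i : OffIdx L // isLead i = true} = 3 := by
  have e : {i : OffIdx L // isLead i = true} ≃ Fin 3 :=
    { toFun := fun i => i.1.1.2
      invFun := fun μ => ⟨⟨(Pi.single μ (-1 : ZMod L), μ), leader_not_treeEdge μ⟩, isLead_lead μ⟩
      left_inv := fun i => Subtype.ext (eq_lead_of_isLead i.2).symm
      right_inv := fun μ => rfl }
  rw [Fintype.card_congr e, Fintype.card_fin]

/-- ★ **THE FOLLOWER COUNT**: `card (Fol L) = 6L⁴ − 3` (`(2L³ + 1 − 3) + (2L − 1)·3L³ + (L³ − 1)`, ✓`card_offIdx`, ✓`card_nonleaders`). [folklore] -/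
theorem card_fol : Fintype.card (Fol L) = 6 * L ^ 4 - 3 := by
  rw [Fintype.card_sum, Fintype.card_sum, Fintype.card_prod, Fintype.card_fin, Fintype.card_subtype_compl, card_isLead, card_offIdx,
    Fintype.card_subtype_compl, Fintype.card_subtype_eq, FemtoTransferGap.card_edge_three, TwoLattice.Electric.card_site,
    ← card_nonleaders (L := L) NeZero.one_le]
  ring

end Summit.QuantumFields.YangMills.Theorems.SwapVirialDeficit.BlowUpRing

end
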